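import Literature.AlgebraicGeometry.Hyperkaehler.KummerTypeDominatedByWeilFourfoldPowers
import Literature.AlgebraicGeometry.Hyperkaehler.KugaSatakeCorrespondenceHyperkaehler
import Literature.AlgebraicGeometry.Hyperkaehler.K3HilbertType
import Literature.AlgebraicGeometry.Surfaces.K3PowersHodgeOfTranscendentalLattice
import HarnessLib

/-!
# `K3^[n]`-type varieties whose transcendental lattice embeds in `U³ ⊕ ⟨-a⟩` are cohomologically dominated by the powers of a discriminant-1 Weil abelian fourfold; the Hodge conjecture for all their powers (Floccari–Fu 2026, *The hyper-Kummer construction*, Thm. 13.2 (i) = Thm. K (i), Cor. 13.4 — PREPRINT) — NAMED FACT + kernel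

Layer `Literature/AlgebraicGeometry/Hyperkaehler`.  Companion of `KummerTypeDominatedByWeilFourfoldPowers`
(items (ii)(iii) of the same theorem, for `Kum²`/`Kum³`): item (i) for varieties of `K3^[n]`-type,
`n ≥ 2` — the case of K3 SURFACES in item (i) is Floccari, Geom. Topol. 30 (2026) Thm. 5.11, a REFEREED
record of the tree (`Surfaces.Floccari2026_hodgeClasses_algebraic_powers_of_K3_of_transcendental_embedding`,
`Surfaces.Floccari2026_kugaSatakeCorrespondence_algebraic_of_K3_of_transcendental_embedding`, file
`Surfaces/K3PowersHodgeOfTranscendentalLattice`, whose lattice vocabulary `U3mIndex`, `u3mGram`, `u3mFormQ`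
this file reuses) and is NOT restated.  Cross-ladder literature-typing layer D-0088(4), tranche LT-H4,
seat `hodge-lit-oqh-2` (gen 5).  HONEST FRAMING: typed ≠ proved ≠ endorsed; the source is a PREPRINT
(arXiv, July 2026), graded PREPRINT on every declaration that depends on it; nothing here asserts the
Hodge conjecture for `K3^[n]`-type varieties in general (LADDER-HodgeAV: "K3^[n]/OG10 stay open"), only —
as a PRINTED, unrefereed theorem recorded as a named fact — for the countable union of families singled
out by the lattice condition.

## Source of record (read at source; locators = materialised arXiv text `paper:arxiv-2607.07528`)

S. Floccari, L. Fu, *The hyper-Kummer construction*, arXiv:2607.07528 (July 2026) [`FloccariFu2026HyperKummer`;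
PREPRINT].  Verbatim:
* **Theorem 13.2 (i)** [p0086:L14–L18, L22–L24]: "Consider the following hyper-Kähler varieties: (i) any
  K3 surface or `K3^[n]`-type variety satisfying the following condition: there exists an isometric
  embedding of rational quadratic spaces `H²_tr(X,ℚ) ↪ U_ℚ^{⊕3} ⊕ ⟨-a⟩_ℚ`, for some positive integer `a`.
  […] Then the Kuga–Satake variety `KS(X)` of `X` is isogenous to a power of an abelian fourfold of Weil
  type with discriminant `1`, and Conjecture 13.1 holds for the homological motive of `X`, that is, `h(X)`
  belongs to the thick tensor subcategory of homological motives generated by the motive of `KS(X)`."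
  Proof of (i) [p0086:L25–L28]: "For a K3 surface `S` satisfying the condition in (i), the conclusion
  follows from [Flo26, Theorem 5.11]. If `X` is a `K3^[n]`-type variety as in (i), then `X` is birational
  to a smooth and projective moduli space on a K3 surface `S` as above, by [Add16]. The Kuga–Satake variety
  of `X` is isogenous to that of `S`. By [Rie14, Bül20], `X` is motivated by `S`, and therefore Conjecture
  13.1 holds for `X` as well."  ([Add16] = N. Addington, Math. Res. Lett. 23 (2016); [Rie14] = U. Rieß;
  [Bül20] = T.-H. Bülles.)
* **Corollary 13.4** [p0088:L9–L12] ("In particular, the Hodge conjecture holds for all powers of any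
  hyper-Kähler variety `X` as in Theorem 13.2.") and its proof [p0088:L13–L26] ("each of the Kuga–Satake
  varieties `KS(X_i)` is isogenous to some power of the same abelian fourfold `A`, which is of Weil type
  with discriminant `1`. Therefore, the tensor subcategories `⟨h(KS(X_i))⟩` of `Mot` all coincide with
  `⟨h(A)⟩`. The Hodge conjecture has been established for any abelian fourfold of Weil type with
  discriminant `1` [Mar22] and all its powers [Flo26] […] Hence […] the Hodge conjecture holds for (all
  powers of) `Y`.") — quoted in full in the companion file.
* Introduction, **Theorem K** (i) [p0013:L35–p0014:L9]: the same, with "Moreover, the Hodge conjecture and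
  the Tate conjecture hold for `X` and any of its powers."

## Rendering on the tree's real carriers (what a reviewer must accept), and faithfulness

* "`K3^[n]`-type variety" (a projective hyper-Kähler manifold deformation equivalent to the Hilbert scheme
  `S₀^[n]` of a K3 surface): `2 ≤ n`, `Motives.IsSmoothProjective (2 * n) X`, `Hyperkaehler.IsOfK3HilbertType n X`
  (file `K3HilbertType`; the rendering of the tree's `K3^[n]` records, e.g. `Markman2024_…`).  The K3
  SURFACE case of item (i) is the tree's REFEREED Floccari 2026 record (above) and is left out here
  (WEAKER than print by omission, never stronger).
* "`H²_tr(X, ℚ)` with its Beauville–Bogomolov form": a presentation `(T, H, P, j)` of the transcendental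
  part relative to a Fujiki form `b` and a Hodge-symmetric Hodge model `M`
  (`Hyperkaehler.IsTranscendentalPartHK hX M hM b H P j`, file `KugaSatakeCorrespondenceHyperkaehler`: `j`
  injective with image `NS(X)_ℚ^{⊥_b}`, `P ⊗ 1 = b|_T`).  SIGN: the tree's polarizations satisfy the
  untwisted Hodge–Riemann relation `i^{p-q} Q(x, x̄) > 0` (`Motives.HodgeStructure.Polarization`, Voisin I
  §7.1.2), so on a weight-`2` structure `P` is NEGATIVE on `(H^{2,0} ⊕ H^{0,2})_ℝ` and positive on
  `H^{1,1}_ℝ`: `P = -c · q_X|_T` for a positive rational `c` (the clause `P ⊗ 1 = b|_T` forces the Fujiki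
  scalar of `b` to be `-c`; cf. the non-vacuity note "`b = -q_X ⊗ ℂ`" of `IsTranscendentalPartHK`).  Hence
  the printed condition "isometric embedding `(H²_tr(X,ℚ), q_X) ↪ U_ℚ^{⊕3} ⊕ ⟨-a⟩_ℚ` for some positive
  integer `a`" is rendered as: an INJECTIVE `ℚ`-linear `ι : T → ℚ⁷` (target indexed by `Surfaces.U3mIndex`,
  form `Surfaces.u3mFormQ a` with Gram matrix `U ⊕ U ⊕ U ⊕ (-a)`) with
  `u3mFormQ a (ι t) (ι t') = -(P.form t t')` — an isometric embedding of `(T, -P) = (T, c·q_X|_T)`.  The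
  positive scalar `c` is immaterial: `(T, c·q) ↪ U³ ⊕ ⟨-a⟩` iff `(T, q) ↪ c⁻¹·(U³ ⊕ ⟨-a⟩) ≅ U³ ⊕ ⟨-a c⟩`
  (`λ·U ≅ U` over `ℚ`), and `⟨-p/q⟩ ≅ ⟨-pq⟩`, so "for some positive integer `a`" is the same condition for
  `q_X|_T` and for every positive rational multiple of it — FAITHFUL.  The hypothesis is placed universally
  over `(b, M, T, H, P, j, a, ι)`: "if SOME presentation embeds" — exactly print's "there exists an
  isometric embedding", all presentations being isometric to `(H²_tr(X,ℚ), -c·q_X)`.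
* Conclusion "`h(X)` belongs to `⟨h(KS(X))⟩ = ⟨h(A)⟩`, `A` of Weil type with discriminant `1`" ⟶ the
  real-carrier CONSEQUENCE `HodgeTheory.IsDominatedByPowers (2 * n) X 4 W.X` for a discriminant-1 Weil
  fourfold datum `(d, W, φ, e, c)` — binder block of `Markman2023_thirdCohomology_kummerType_discOneWeilFourfold`
  ∕ `FloccariFu2026_hodgeClasses_algebraic_powers_discOneWeilFourfold`, symbol for symbol, exactly as in the
  companion file (whose module docstring has the summand-and-retraction argument: weaker-or-equal, converse
  not claimed).
* NOT typed, with reasons: the clause "`KS(X)` is isogenous to a power of an abelian fourfold of Weil type"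
  (as in the companion file: on `H²_tr`-Kuga–Satake carriers the literal sentence fails dimensionally when
  `rk H²_tr(X) ≤ 4`, `dim KS(H²_tr) = 2^{rk-2}`); "`X` is birational to a moduli space of sheaves on `S`"
  ([Add16]; no moduli-of-sheaves carriers); "`X` is motivated by `S`" ([Rie14, Bül20]; typable later as
  `IsDominatedByPowers (2n) X 2 S` if a consumer names it); item (iv) (OG6-resolutions: no carrier, design
  note of `OGradySixType`); Cor. 13.4 for products of Hodge-similar varieties; the Tate clause.

## Content

* NAMED FACT `FloccariFu2026_k3HilbertType_transcendentalEmbedding_isDominatedByPowers_discOneWeilFourfold`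
  (Thm. 13.2 (i) for `K3^[n]`-type, `n ≥ 2`, domination form; PREPRINT) — +1 named fact (D-0026 accounting: a
  theorem with a printed proof in a 2026 preprint; no restatement: the K3-surface case is a different,
  refereed record and is excluded here).
* Kernel, all PROVED (standard axioms), in the fact's namespace: `.exists_fourfold_powers` (the shape
  `∃ B, IsSmoothProjective 4 B ∧ (∀ m, HC(B^{m+1})) ∧ IsDominatedByPowers (2n) X 4 B`, modulo this fact and the
  Floccari–Fu JMPA record), `.hodgeConjectureFor_powers` (= Cor. 13.4 "in particular" for item (i): HC for
  `X` and all powers `X^{m+1}`, modulo the three records — the printed proof, composed),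
  `.k3HilbertSquareType_powers` (the `K3^[2]` spelling, dimension `4`, for the `K3^[2]` routes of
  `HodgeConjecture/HodgeConjecture` as a T3 "S-case in print" input on the lattice locus).
-/

noncomputable section

open CategoryTheory

namespace Literature.AlgebraicGeometry.Hyperkaehler

open HodgeTheory
open Motives (SchemeOver IsSmoothProjective AbelianVariety HodgeStructure)
open Surfaces (U3mIndex u3mFormQ)

/-! ### The named fact (D-0014): Floccari–Fu 2026 Thm. 13.2 (i) for `K3^[n]`-type, domination form -/

/-- **Floccari–Fu 2026 (*The hyper-Kummer construction*), Thm. 13.2 (i) = Thm. K (i), for varieties of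
`K3^[n]`-type — PREPRINT: a projective variety `X` of `K3^[n]`-type whose transcendental lattice
`(H²_tr(X,ℚ), q_X)` embeds isometrically in `U_ℚ^{⊕3} ⊕ ⟨-a⟩_ℚ` for some positive integer `a` is
motivated, in homological motives, by a discriminant-1 abelian fourfold of Weil type** — printed: "any K3
surface or `K3^[n]`-type variety satisfying the following condition: there exists an isometric embedding
of rational quadratic spaces `H²_tr(X,ℚ) ↪ U_ℚ^{⊕3} ⊕ ⟨-a⟩_ℚ`, for some positive integer `a` […] `h(X)`
belongs to the thick tensor subcategory of homological motives generated by the motive of `KS(X)`", with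
"`⟨h(KS(X_i))⟩` […] all coincide with `⟨h(A)⟩`", `A` "of Weil type with discriminant `1`" (proof of
Cor. 13.4).  Rendering (module docstring): for `2 ≤ n`, `X` smooth projective of dimension `2n` of
`K3^[n]`-type, every Fujiki form `b`, Hodge-symmetric model `M` and presentation `(T, H, P, j)` of the
transcendental part (`IsTranscendentalPartHK`; `P = -c·q_X|_T`, `c > 0`, by the tree's Hodge–Riemann sign),
every `a > 0` and every injective `ℚ`-linear `ι : T → ℚ⁷` with `u3mFormQ a (ι t) (ι t') = -(P t t')`
(an isometric embedding `(T, c·q_X|_T) ↪ U³ ⊕ ⟨-a⟩`; the scalar `c` is immaterial, module docstring):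
there is a discriminant-1 Weil fourfold datum `(d, W, φ, e, a')` (binder block of the companion file and
of `FloccariFu2026_hodgeClasses_algebraic_powers_discOneWeilFourfold`) with `X` cohomologically DOMINATED
BY THE POWERS of `W.X` (`HodgeTheory.IsDominatedByPowers (2 * n) X 4 W.X`) — a consequence of the printed
motivic statement (weaker-or-equal; converse not claimed).  Status: PREPRINT theorem (arXiv:2607.07528,
July 2026; its proof composes [Flo26, Thm. 5.11], [Add16], [Rie14, Bül20]); the K3-surface case is the
tree's refereed record `Surfaces.Floccari2026_hodgeClasses_algebraic_powers_of_K3_of_transcendental_embedding`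
and is not restated.  Unproved in the tree; an explicit hypothesis wherever used.
[cite: FloccariFu2026HyperKummer, Thm. 13.2 (i) (arXiv:2607.07528 p. 86 L14–L18, L22–L28) and proof of Cor. 13.4 (p. 88 L13–L26); = Thm. K (i) (pp. 13–14); PREPRINT]
[cite: Floccari2026, Thm. 5.11 (the K3-surface case, cited in the printed proof)]
[cite: Arapura2006, §1 Lemma 1.1 (motivated ⟺ surjection from ⊕ [A]^{⊗e}(m) on cohomology)] -/
def FloccariFu2026_k3HilbertType_transcendentalEmbedding_isDominatedByPowers_discOneWeilFourfold : Prop :=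
  ∀ (n : ℕ), 2 ≤ n → ∀ ⦃X : SchemeOver ℂ⦄ (hX : IsSmoothProjective (2 * n) X), IsOfK3HilbertType n X →
    ∀ (b : complexBetti X 2 →ₗ[ℂ] complexBetti X 2 →ₗ[ℂ] ℂ), IsFujikiForm n X b →
    ∀ (M : HodgeModel (2 * n) X) (hM : M.IsHodgeSymmetric)
      (T : Type) [AddCommGroup T] [Module ℚ T] (H : HodgeStructure T 2) (P : H.Polarization)
      (j : H.Hom (bettiTwoHodgeStructureOfModel hX M hM)),
      IsTranscendentalPartHK hX M hM b H P j →
    ∀ (a : ℕ), 0 < a → ∀ (ι : T →ₗ[ℚ] (U3mIndex → ℚ)), Function.Injective ι →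
      (∀ t t' : T, u3mFormQ a (ι t) (ι t') = -(P.form t t')) →
    ∃ (d : ℕ) (W : AbelianVariety ℂ) (φ : W ⟶ W) (e : Motives.ProjectiveEmbedding W.X)
      (c : complexBetti (Motives.projectiveSpace e.n ℂ) 2),
      0 < d ∧ W.dim = 2 * 2 ∧ φ ≫ φ = -(d • 𝟙 W) ∧ IsRationalClass c ∧ c ≠ 0 ∧
        Motives.IsHyperbolicWeilType W φ 2
          ((d : ℂ) • complexBetti.map e.ι 2 c +
            complexBetti.map φ.hom.hom.hom 2 (complexBetti.map e.ι 2 c)) ∧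
        IsDominatedByPowers (2 * n) X 4 W.X

namespace FloccariFu2026_k3HilbertType_transcendentalEmbedding_isDominatedByPowers_discOneWeilFourfold

variable {n : ℕ} {X : SchemeOver ℂ}

/-- **With the Floccari–Fu JMPA record: such an `X` is dominated by the powers of a smooth projective
FOURFOLD `B` all of whose cartesian powers satisfy the per-variety Hodge statement** (the shape
`∃ B, IsSmoothProjective 4 B ∧ (∀ m, HodgeConjectureFor ((m+1)·4) (B^{m+1})) ∧ IsDominatedByPowers (2n) X 4 B`),
modulo the two records. [cite: FloccariFu2026HyperKummer, Thm. 13.2 (i) and proof of Cor. 13.4 (p. 88); PREPRINT]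
[cite: FloccariFu2026, Thm. 1.2 (HC for all powers of a discriminant-1 Weil fourfold)] -/
theorem exists_fourfold_powers
    (h : FloccariFu2026_k3HilbertType_transcendentalEmbedding_isDominatedByPowers_discOneWeilFourfold)
    (hFF : FloccariFu2026_hodgeClasses_algebraic_powers_discOneWeilFourfold)
    (hn : 2 ≤ n) (hX : IsSmoothProjective (2 * n) X) (hK : IsOfK3HilbertType n X)
    {b : complexBetti X 2 →ₗ[ℂ] complexBetti X 2 →ₗ[ℂ] ℂ} (hb : IsFujikiForm n X b)
    {M : HodgeModel (2 * n) X} {hM : M.IsHodgeSymmetric}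
    {T : Type} [AddCommGroup T] [Module ℚ T] {H : HodgeStructure T 2} {P : H.Polarization}
    {j : H.Hom (bettiTwoHodgeStructureOfModel hX M hM)} (hT : IsTranscendentalPartHK hX M hM b H P j)
    {a : ℕ} (ha : 0 < a) {ι : T →ₗ[ℚ] (U3mIndex → ℚ)} (hι : Function.Injective ι)
    (hiso : ∀ t t' : T, u3mFormQ a (ι t) (ι t') = -(P.form t t')) :
    ∃ B : SchemeOver ℂ, IsSmoothProjective 4 B ∧
      (∀ m : ℕ, HodgeConjectureFor ((m + 1) * 4) (B.pow (m + 1))) ∧ IsDominatedByPowers (2 * n) X 4 B := by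
  obtain ⟨d, W, φ, e, c, hd, hW, hφ, hc, hc0, hyp, hdom⟩ :=
    h n hn hX hK b hb M hM T H P j hT a ha ι hι hiso
  have hB : IsSmoothProjective 4 W.X := by
    have hB' : IsSmoothProjective W.dim W.X := Motives.AbelianVariety.isSmoothProjective_holds
    rwa [hW] at hB'
  refine ⟨W.X, hB, fun m ↦ ?_, hdom⟩
  simpa [hW] using hodgeConjectureFor_pow_of_forall_powSucc W
    (hodgeConjectureFor_powSucc_of_floccariFu hFF hd W φ hW hφ e c hc hc0 hyp) m

/-- **Floccari–Fu 2026, Cor. 13.4 for item (i), `K3^[n]`-type — AS A KERNEL THEOREM modulo three records:**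
for `2 ≤ n` and `X` smooth projective of `K3^[n]`-type whose transcendental lattice embeds isometrically in
`U³ ⊕ ⟨-a⟩` (some `a > 0`; rendered on a presentation as in the fact), the per-variety Hodge statement holds
for `X` and for every cartesian power `X^{m+1}` — this file's fact, the Floccari–Fu JMPA record (powers of
disc-1 Weil fourfolds) and Arapura 2006 Lemma 4.2, composed as in print ("In particular, the Hodge
conjecture holds for all powers of any hyper-Kähler variety `X` as in Theorem 13.2").  PREPRINT (the first
record). [cite: FloccariFu2026HyperKummer, Cor. 13.4 (p. 88 L9–L26) = Thm. K (i) "Moreover" (p. 14 L5–L9); PREPRINT]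
[cite: Arapura2006, Lemma 4.2] [cite: FloccariFu2026, Thm. 1.2] -/
theorem hodgeConjectureFor_powers
    (h : FloccariFu2026_k3HilbertType_transcendentalEmbedding_isDominatedByPowers_discOneWeilFourfold)
    (hFF : FloccariFu2026_hodgeClasses_algebraic_powers_discOneWeilFourfold)
    (h42 : Arapura2006_hodgeClasses_algebraic_of_isDominatedByPowers)
    (hn : 2 ≤ n) (hX : IsSmoothProjective (2 * n) X) (hK : IsOfK3HilbertType n X)
    {b : complexBetti X 2 →ₗ[ℂ] complexBetti X 2 →ₗ[ℂ] ℂ} (hb : IsFujikiForm n X b)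
    {M : HodgeModel (2 * n) X} {hM : M.IsHodgeSymmetric}
    {T : Type} [AddCommGroup T] [Module ℚ T] {H : HodgeStructure T 2} {P : H.Polarization}
    {j : H.Hom (bettiTwoHodgeStructureOfModel hX M hM)} (hT : IsTranscendentalPartHK hX M hM b H P j)
    {a : ℕ} (ha : 0 < a) {ι : T →ₗ[ℚ] (U3mIndex → ℚ)} (hι : Function.Injective ι)
    (hiso : ∀ t t' : T, u3mFormQ a (ι t) (ι t') = -(P.form t t')) :
    HodgeConjectureFor (2 * n) X ∧ ∀ m : ℕ, HodgeConjectureFor ((m + 1) * (2 * n)) (X.pow (m + 1)) := by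
  obtain ⟨B, hB, hpow, hdom⟩ := exists_fourfold_powers h hFF hn hX hK hb hT ha hι hiso
  exact h42 hB hX hdom hpow

/-- The `K3^[2]`-type spelling (dimension `4`, `IsOfK3HilbertSquareType`): Cor. 13.4 (i) for a smooth
projective fourfold of `K3^[2]`-type whose transcendental lattice embeds in `U³ ⊕ ⟨-a⟩` — the per-variety
Hodge statement for `X` and all powers `X^{m+1}`, modulo the three records (a T3 "S-case in print" input for
the `K3^[2]` routes of `HodgeConjecture/HodgeConjecture`, on the lattice locus only; PREPRINT).
[cite: FloccariFu2026HyperKummer, Thm. 13.2 (i) and Cor. 13.4; PREPRINT] -/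
theorem k3HilbertSquareType_powers
    (h : FloccariFu2026_k3HilbertType_transcendentalEmbedding_isDominatedByPowers_discOneWeilFourfold)
    (hFF : FloccariFu2026_hodgeClasses_algebraic_powers_discOneWeilFourfold)
    (h42 : Arapura2006_hodgeClasses_algebraic_of_isDominatedByPowers)
    (hX : IsSmoothProjective (2 * 2) X) (hK : IsOfK3HilbertSquareType X)
    {b : complexBetti X 2 →ₗ[ℂ] complexBetti X 2 →ₗ[ℂ] ℂ} (hb : IsFujikiForm 2 X b)
    {M : HodgeModel (2 * 2) X} {hM : M.IsHodgeSymmetric}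
    {T : Type} [AddCommGroup T] [Module ℚ T] {H : HodgeStructure T 2} {P : H.Polarization}
    {j : H.Hom (bettiTwoHodgeStructureOfModel hX M hM)} (hT : IsTranscendentalPartHK hX M hM b H P j)
    {a : ℕ} (ha : 0 < a) {ι : T →ₗ[ℚ] (U3mIndex → ℚ)} (hι : Function.Injective ι)
    (hiso : ∀ t t' : T, u3mFormQ a (ι t) (ι t') = -(P.form t t')) :
    HodgeConjectureFor 4 X ∧ ∀ m : ℕ, HodgeConjectureFor ((m + 1) * 4) (X.pow (m + 1)) :=
  hodgeConjectureFor_powers h hFF h42 (n := 2) le_rfl hX hK hb hT ha hι hiso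

end FloccariFu2026_k3HilbertType_transcendentalEmbedding_isDominatedByPowers_discOneWeilFourfold

end Literature.AlgebraicGeometry.Hyperkaehler

end
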